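import Literature.NumberTheory.EllipticCurves.Kato2004.MemberMultiplierInputs
import HarnessLib

/-!
# Tightness lemma for the rank-ONE residual (K9 `WildRankOne` 19200 / KT `TameRankOne` 19984):
# the tree's Kato zeta classes (`Kato2004.ZetaBody`) are pinned only PROJECTIVELY — scaling the
# classes, the values and the real constant by the same natural number preserves every clause

Cell `bsd-potss` (FULL-BSD rank ≤ 1, tranche 1b), seat `bsd-potss-kmc` (descent from Kato's Λ-adic main
conjecture), generation 10, part 17c; memo HOME/bsd-potss-kmc/KMC-DESCENT-MEMO-v9.md §1 finding F2.
ROUTE-FREE (no route import); `--supports stmt-BirchSwinnertonDyer-19200`.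

WHAT THIS SHOWS.  The matrix `ZetaBody W p f ι κ Λ c d a A z x` of the named fact
`Kato2004.exists_eulerSystem_expStar_values` (and of the member facts `exists_memberHullInputs`,
`exists_memberHullCountInputs`, `exists_memberHullMultiplierInputs`) is HOMOGENEOUS: if `(κ, Λ, z, x)`
satisfies it then so does `(n·κ, Λ, n•z, n·x)` for every `n : ℕ` (`zetaBody_smul`), and the guard
`κ ≠ 0` survives for `n ≠ 0` (`zetaBody_guards_smul`).  The dual exponential `Λ` being an ABSTRACT
functional with a FREE real normalisation `κ` (design (P2)/F-κ of `EulerSystemValues.lean`), Kato's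
classes `_{c,d}z_m` are therefore pinned by the tree only up to a non-zero rational scalar, and the
`Λ`-adic lift `𝐲 ∈ 𝐇¹_Γ(T_pW)` (`IwasawaH1Data.existsUnique_lift_of_zetaBody`) only up to `ℚ^×`.
CONSEQUENCE (memo v9 §1–§2): every rank-`0` statement of the cell is homogeneous of degree `0` in this
scaling (the abstract multiplier `λ(0)`/index absorb it) — sound; but Perrin-Riou's conjecture up to a
`p`-adic unit for the pinned class (`v_p(L′/(Ω·Reg)) = pos(𝐲₀) − v_p log_ω(x) − v_p λ(0)`) and «Kato's
Conj. 12.10 at `X = 0`» at the member are EACH of degree `±1` (the position `pos(𝐲₀)` of `𝐲₀` in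
`H¹_f(ℚ,T)/tors` shifts by `v_p n`), hence NOT closed statements over the tree's zeta data: a node
quantified over ALL `ZetaBody` data is false (take `n = p`), one quantified over SOME is manufacturable;
only their conjunction (`BSD(E,p)` at the member) and the count are scale-invariant.  So the residual
items 19200/19984 cannot be split over a Perrin-Riou node and a `12.10`-at-`X = 0` node in the present
currency; what is missing is a DEFINED `exp*_ω` (or local Tate duality for `T_pE` tying `Λ` to
`log_ω ∘ Kummer`) — definition request recorded in the memo.  Nothing here is asserted about BSD.

References: K. Kato, Astérisque 295 (2004) §9.4 (`exp*`), Thm. 9.7, Thm. 6.6 (1), Thm. 12.5 (1)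
[Kato2004Asterisque]; D. Burns, M. Kurihara, T. Sano, arXiv:1910.07404, Conj. 2.8 / Thm. 1.4
[BurnsKuriharaSano2019]; tree `Kato2004/EulerSystemValues.lean` (`ZetaBody`, (P2)),
`GaloisRepresentations/EulerSystem.lean` (`IsEulerSystem.smul`).
-/

set_option autoImplicit false
set_option linter.dupNamespace false

noncomputable section

open scoped NumberField TensorProduct
open Field IsDedekindDomain CongruenceSubgroup
open Literature.NumberTheory.GaloisRepresentations
open Literature.NumberTheory.EllipticCurves Literature.NumberTheory.EllipticCurves.ModularForms
open Literature.NumberTheory.EllipticCurves.Kato2004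
open Literature.NumberTheory.EllipticCurves.Kato2004.EulerSystemValues Rat.HeightOneSpectrum

namespace Summit.BirchSwinnertonDyer.BirchSwinnertonDyer.Theorems.ZetaBodyScaling

section Scaling

variable {W : WeierstrassCurve ℚ} [W.IsElliptic] {p : ℕ} [Fact p.Prime]
  [ContinuousSMul ℤ_[p] (W.tateModule p)] [Module.Free ℤ_[p] (W.tateModule p)]
  [Module.Finite ℤ_[p] (W.tateModule p)] {N : ℕ} {f : CuspForm (Gamma0 N) 2}
  {ι : (m : ℕ) → (CyclotomicField m ℚ →+* ℂ)} {κ : ℝ}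
  {Λ : ∀ (k : ℕ) (r : Finset (HeightOneSpectrum (𝓞 ℚ))),
    H1 (tateRep W p) (cycSubgroup p k r) →ₗ[ℤ_[p]] ℚ_[p] ⊗[ℚ] CyclotomicField (cycLevel p k r) ℚ}
  {c d a : ℤ} {A : ℕ}
  {z : ∀ (k : ℕ) (r : (cyclotomicLevelsRat p (badPlaces c d A N)).Ideals),
    H1 (tateRep W p) ((cyclotomicLevelsRat p (badPlaces c d A N)).level k r.1)}
  {x : ∀ (k : ℕ) (r : (cyclotomicLevelsRat p (badPlaces c d A N)).Ideals),
    CyclotomicField (cycLevel p k r.1) ℚ}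

/-- Kato's character sum is `ℕ`-homogeneous in its argument: `Σ_b χ(b) ι(σ_b (n·x)) = n · Σ_b χ(b) ι(σ_b x)`
(`σ_b` and `ι` are ring homomorphisms). [cite: Kato2004Asterisque, Thm. 6.6 (1) (p. 163)] -/
theorem charSum_natCast_mul (m : ℕ) [NeZero m] (ιm : CyclotomicField m ℚ →+* ℂ)
    (χ : DirichletCharacter ℂ m) (n : ℕ) (y : CyclotomicField m ℚ) :
    charSum m ιm χ ((n : CyclotomicField m ℚ) * y) = (n : ℂ) * charSum m ιm χ y := by
  simp only [charSum, map_mul, map_natCast, Finset.mul_sum]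
  refine Finset.sum_congr rfl fun b _ ↦ ?_
  ring

/-- **The zeta-class matrix is homogeneous (tightness lemma for the rank-one residual).**  If
`(κ, Λ, z, x)` satisfies `ZetaBody W p f ι κ Λ c d a A z x` then so does `(n·κ, Λ, n•z, n·x)` for every
`n : ℕ`: the Euler-system relations (C1) and unramifiedness (C2) are `ℤ_p`-linear in `z`
(`IsEulerSystem.smul`, linearity of restriction), the datum axioms (C3a)/(C3b) concern `Λ` only,
rationality (C4) is linear (`Λ(n•z) = 1 ⊗ (n·x)`), and the value law (C5) scales by `n` on both sides
(`charSum_natCast_mul`; the constant becomes `n·κ`).  Hence the tree pins Kato's classes only up to a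
scalar — the obstruction of memo v9 §1 F2 to a closed Perrin-Riou node.
[cite: Kato2004Asterisque, (8.1.3) (p. 180), Thm. 9.7 (p. 189), Thm. 6.6 (1) (p. 163)] -/
theorem zetaBody_smul (n : ℕ) (h : ZetaBody W p f ι κ Λ c d a A z x) :
    ZetaBody W p f ι ((n : ℝ) * κ) Λ c d a A ((n : ℤ_[p]) • z)
      (fun k r ↦ (n : CyclotomicField (cycLevel p k r.1) ℚ) * x k r) := by
  obtain ⟨h1, h2, h3a, h3b, h4, h5⟩ := h
  refine ⟨h1.smul (n : ℤ_[p]), ?_, h3a, h3b, ?_, ?_⟩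
  · -- (C2) unramifiedness is linear
    intro k r v hv 𝔓 h𝔓
    have h0 := h2 k r v hv 𝔓 h𝔓
    change (resLe (tateRep W p).toTopRep _ 1) ((n : ℤ_[p]) • z k r) = 0
    rw [map_smul, h0, smul_zero]
  · -- (C4) rationality is linear
    intro k r
    have hlin : Λ k r.1 (((n : ℤ_[p]) • z) k r) = (n : ℤ_[p]) • Λ k r.1 (z k r) :=
      (Λ k r.1).map_smul (n : ℤ_[p]) (z k r)
    rw [hlin, h4 k r]
    change (n : ℤ_[p]) • ((1 : ℚ_[p]) ⊗ₜ[ℚ] x k r) =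
      (1 : ℚ_[p]) ⊗ₜ[ℚ] ((n : CyclotomicField (cycLevel p k r.1) ℚ) * x k r)
    rw [← nsmul_eq_mul, TensorProduct.tmul_smul, Nat.cast_smul_eq_nsmul ℤ_[p]]
  · -- (C5) the value law scales by `n`
    intro k r d' χ Lχ hcd hd' hL
    obtain ⟨heven, hodd⟩ := h5 k r d' χ Lχ hcd hd' hL
    refine ⟨fun hχ ↦ ?_, fun hχ ↦ ?_⟩
    · rw [charSum_natCast_mul, heven hχ]
      push_cast
      ring
    · rw [charSum_natCast_mul, hodd hχ]
      push_cast
      ring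

/-- The guards of the existence facts survive the scaling for `n ≠ 0`: `n·κ ≠ 0`, and `A`, `c`, `d`
are untouched.  With `zetaBody_smul`: the matrix `κ' ≠ 0 ∧ 0 < A ∧ (c,6pA) = 1 ∧ (d,6pN) = 1 ∧ ZetaBody …`
of `exists_eulerSystem_expStar_values` / `exists_memberHullInputs` is satisfied by `(n·κ', Λ', n•z, n·x)`
whenever it is by `(κ', Λ', z, x)`. [cite: Kato2004Asterisque, Ex. 13.3 (p. 225)] -/
theorem zetaBody_guards_smul {n : ℕ} (hn : n ≠ 0) (hκ : κ ≠ 0) (hA : 0 < A)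
    (hc : Int.gcd c (6 * p * A) = 1) (hd : Int.gcd d (6 * p * N) = 1)
    (h : ZetaBody W p f ι κ Λ c d a A z x) :
    (n : ℝ) * κ ≠ 0 ∧ 0 < A ∧ Int.gcd c (6 * p * A) = 1 ∧ Int.gcd d (6 * p * N) = 1 ∧
      ZetaBody W p f ι ((n : ℝ) * κ) Λ c d a A ((n : ℤ_[p]) • z)
        (fun k r ↦ (n : CyclotomicField (cycLevel p k r.1) ℚ) * x k r) :=
  ⟨mul_ne_zero (by exact_mod_cast hn) hκ, hA, hc, hd, zetaBody_smul n h⟩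

end Scaling

/-! ## Appended (kmc g10): the Λ-adic LIFT scales with the classes -/

section Lift

variable {W : WeierstrassCurve ℚ} [W.IsElliptic] {p : ℕ} [Fact p.Prime]
  [ContinuousSMul ℤ_[p] (W.tateModule p)] {N : ℕ} {c d a : ℤ} {A : ℕ}
  {z : ∀ (k : ℕ) (r : (cyclotomicLevelsRat p (badPlaces c d A N)).Ideals),
    H1 (tateRep W p) ((cyclotomicLevelsRat p (badPlaces c d A N)).level k r.1)}
  {κ : ZpExtension ℚ p} {γ : absoluteGaloisGroup ℚ} (hκ : κ.IsCyclotomic) (hp : p ≠ 2)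
  (I : IwasawaH1Data W p κ γ) {y : I.H}

/-- **The Λ-adic lift scales with the classes.**  If `𝐲 ∈ 𝐇¹_Γ(T_pW)` lifts the corestricted `p`-power
levels of the family `z` (the hypothesis of the member facts `exists_memberHullInputs` /
`exists_memberHullCountInputs` / `exists_memberHullMultiplierInputs`), then `n • 𝐲` lifts those of the
scaled family `n • z` (`I.proj` additive, `levelToLayer` `ℤ_p`-linear).  With `zetaBody_smul`: the data
entering the member facts are pinned only up to `𝐲 ↦ n • 𝐲`; in rank one the bottom layer `𝐲₀`, its
`p`-divisibility position in `H¹_f(ℚ,T)/tors` and the genuine multiplier all shift by `v_p n` (memo v9 F2).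
[cite: Kato2004Asterisque, Thm. 13.4 (p. 226), Lemma 13.10 (1) (p. 230)] -/
theorem zetaLift_smul (n : ℕ)
    (hy : ∀ m : ℕ, I.proj m y = levelToLayer W p hκ hp (badPlaces c d A N) m
      (z (m + 1) (cyclotomicLevelsRat p (badPlaces c d A N)).idealOne)) :
    ∀ m : ℕ, I.proj m (n • y) = levelToLayer W p hκ hp (badPlaces c d A N) m
      (((n : ℤ_[p]) • z) (m + 1) (cyclotomicLevelsRat p (badPlaces c d A N)).idealOne) := by
  intro m
  have hlin := (levelToLayer W p hκ hp (badPlaces c d A N) m).map_smul (n : ℤ_[p])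
    (z (m + 1) (cyclotomicLevelsRat p (badPlaces c d A N)).idealOne)
  rw [map_nsmul, hy m, ← Nat.cast_smul_eq_nsmul ℤ_[p] n]
  exact hlin.symm

end Lift

end Summit.BirchSwinnertonDyer.BirchSwinnertonDyer.Theorems.ZetaBodyScaling

end
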